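import Summits.BirchSwinnertonDyer.BirchSwinnertonDyer.Theses.TangentCone
import Summits.BirchSwinnertonDyer.BirchSwinnertonDyer.Theorems.TangentConeEdgeDecayStubTwoVarRateOfOrder
import Literature.NumberTheory.EllipticCurves.PAdicLFunctionRiemannSumCertificateProofs
import Literature.NumberTheory.EllipticCurves.PAdicLFunctionIntegralityProofs
import Literature.NumberTheory.EllipticCurves.GreenbergStevensRatioInterpolation
import HarnessLib

/-!
# BirchSwinnertonDyer / TangentCone — crux `EdgeDecay` (stmt-BirchSwinnertonDyer-17608), line `lambda-layer-one`:
# the conditional bridge `C⁺ → modularity → GS ratio interpolation → EdgeDecay`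

Lead `prover-line-stmt-BirchSwinnertonDyer-17608-0`; skeleton `Cruxes/EdgeDecay/Lines/lambda_layer_one.lean` (v8). This
file lands the line's COMPOSITION as a kernel-checked theorem (registered stub `stub_edgeDecay_of_layerOneUnit`): the crux
`EdgeDecay` — at ONE admissible prime the edge critical-value ratios `Λ(g_k,s)/Λ(g_k,j)` of the Hida branch through
`f_E` decay `p`-adically at rate `≤ r_an` — follows from

* C⁺ `LayerOneUnitSomewhere` (conjecture-grade; the line's one bet): for `E` of analytic rank `≥ 2` with a big-image
  good ordinary prime there is an ADMISSIBLE `p > r_an` (good ordinary, `a_p² ≢ 1 (mod p)`, `ρ̄` surjective, (Br))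
  at which some level-`p²` Riemann sum `RS(j,1)` of the Mazur–Swinnerton-Dyer measure `μ_{f_E,α}`, `j ≤ r_an`, is a
  `p`-adic unit (⟺ `μ_p(E) = 0 ∧ λ_p(E) ≤ r_an`; Kundu–Ray 2021: conjecturally density one in `p`);
* modularity, the named fact `exists_isNewformOf`;
* the Greenberg–Stevens / Kitagawa two-variable interpolation in ratio form, the named fact
  `greenbergStevens_kitagawa_ratio_interpolation` (GS93 Thm 5.15, Delbourgo 2008 Thm 4.11 / p. 100).

Mechanism: C⁺ ⇒ `ord_T L_p(f_E, α; T) ≤ j ≤ r_an` by the tree's Riemann-sum certificate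
(`order_padicLFunction_le_of_riemannSum_certificate` with `C = 1`, `n = 1`: the measure is `ℤ_p`-valued at an
admissible prime — `lambdaLayerOne_norm_msdMeasure_le_one`, from `norm_msdMeasure_le_one` at `ℓ = p` — and
`‖j!‖_p = 1` for `j < p`); then `lambdaLayerOne_gsTotalDecayLeCycOrder` (verbatim the registered XL stub
`stub_gsTotalDecayLeCycOrder` of line `ub_schneider_squeeze`, conditional on the GS fact): a non-zero coefficient of
`L_p` in degree `≤ n` is a non-zero coefficient of the two-variable series `F` on the axis, the landed analytic rate
lemma `stub_twoVarRateOfOrder` (lattice slope `a/b < 1/2` off the zeros of the lowest form + dominant term + LTE) gives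
the rate along `k = 2 + b t`, `t = 2(p-1)p^{m+m₀}t₀`, and the ratio interpolation converts it into the edge ratios.
-/

set_option linter.dupNamespace false

namespace Summit.BirchSwinnertonDyer.BirchSwinnertonDyer.Theorems

open scoped Classical
open Filter Topology

/-- **The integrality conjunct of the card's C⁺ is a theorem** (found by the C⁺ vetting worker of line `lambda-layer-one`): for `5 ≤ p` good
ordinary with `p ∤ a_p² - 1` and `f` the newform of `W`, `‖μ_{f,α}(a + pⁿℤ_p)‖ ≤ 1` for all `n, a` (`α = unitRoot W p`),
by the tree's Eisenstein-multiple mechanism at `ℓ = p` (`norm_msdMeasure_le_one`: `(a_p − p − 1)·[r] ∈ Λ_f`,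
and `a_p − p − 1 ≡ a_p − 1 ≢ 0 mod p`). [folklore] -/
theorem lambdaLayerOne_norm_msdMeasure_le_one {N : ℕ} [NeZero N]
    {f : CuspForm (CongruenceSubgroup.Gamma0 N) 2} {p : ℕ} [Fact p.Prime] {W : WeierstrassCurve ℚ} [W.IsElliptic]
    [W.IsGloballyMinimal] (hp5 : 5 ≤ p) (hgood : W.HasGoodReductionAtPrime p)
    (hord : ¬ (p : ℤ) ∣ W.frobeniusTrace p)
    (hna : ¬ (p : ℤ) ∣ (W.frobeniusTrace p) ^ 2 - 1) (hf : Literature.NumberTheory.EllipticCurves.ModularForms.IsNewformOf W f)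
    (n : ℕ) (a : ZMod (p ^ n)) :
    ‖Literature.NumberTheory.EllipticCurves.msdMeasure f (Literature.NumberTheory.EllipticCurves.unitRoot W p : ℚ_[p]) n a‖ ≤ 1 := by
  have hp : p.Prime := Fact.out
  have hp2 : p ≠ 2 := by omega
  have hordW : Literature.NumberTheory.EllipticCurves.IsOrdinaryAt W p := ⟨hgood, hord⟩
  have hpN : ¬ p ∣ N := Literature.NumberTheory.EllipticCurves.not_dvd_level_of_isNewformOf hf hgood
  have hap : Literature.NumberTheory.EllipticCurves.ModularForms.cuspCoeff f p = ((W.frobeniusTrace p : ℤ) : ℂ) :=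
    Literature.NumberTheory.EllipticCurves.cuspCoeff_eq_frobeniusTrace_of_isNewformOf_holds hf hgood
  have h := Literature.NumberTheory.EllipticCurves.ModularForms.sub_mul_modularSymbol_zero_mem_periodLattice hf.1 hp hpN
  rw [hap] at h
  refine Literature.NumberTheory.EllipticCurves.norm_msdMeasure_le_one hp2 hpN
    (n₀ := W.frobeniusTrace p - (p + 1)) ?_ ?_
    (Literature.NumberTheory.EllipticCurves.unitRoot_coe_spec (W := W) hordW).2.1 n a
  · intro hdvd
    apply hna
    have : W.frobeniusTrace p ^ 2 - 1 =
        (W.frobeniusTrace p - (p + 1) + p) * (W.frobeniusTrace p + 1) := by ring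
    rw [this]
    exact dvd_mul_of_dvd_left (dvd_add hdvd (dvd_refl _)) _
  · push_cast
    convert h using 2
    ring

/-- **Layer-one unit certificate ⇒ `ord_T L_p ≤ j`**: the instance `C = 1`, `n = 1`, `j < p` of the tree theorem
`order_padicLFunction_le_of_riemannSum_certificate` (`‖j!‖_p = 1`, `p⁻¹ < 1 = ‖RS(j,1)‖`). [folklore] -/
theorem lambdaLayerOne_order_le_of_layerOneUnit {N : ℕ} [NeZero N] {f : CuspForm (CongruenceSubgroup.Gamma0 N) 2}
    {p : ℕ} [Fact p.Prime] {W : WeierstrassCurve ℚ} [W.IsGloballyMinimal] [W.IsElliptic]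
    (hord : Literature.NumberTheory.EllipticCurves.IsOrdinaryAt W p) (hf : Literature.NumberTheory.EllipticCurves.ModularForms.IsNewformOf W f)
    (hμ : ∀ (n : ℕ) (a : ZMod (p ^ n)), ‖Literature.NumberTheory.EllipticCurves.msdMeasure f (Literature.NumberTheory.EllipticCurves.unitRoot W p : ℚ_[p]) n a‖ ≤ 1)
    {j : ℕ} (hj : j < p) (hunit : ‖Literature.NumberTheory.EllipticCurves.padicLRiemannSum f (Literature.NumberTheory.EllipticCurves.unitRoot W p : ℚ_[p]) j 1‖ = 1) :
    (Literature.NumberTheory.EllipticCurves.padicLFunction f (Literature.NumberTheory.EllipticCurves.unitRoot W p : ℚ_[p])).order ≤ j := by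
  have hp : p.Prime := Fact.out
  apply Literature.NumberTheory.EllipticCurves.order_padicLFunction_le_of_riemannSum_certificate
    hord hf hμ (n := 1)
  have hfac : ‖((j.factorial : ℕ) : ℚ_[p])‖ = 1 := by
    rw [Padic.norm_natCast_eq_one_iff]
    exact (Nat.Prime.coprime_iff_not_dvd hp).mpr (fun h => absurd ((hp.dvd_factorial).mp h) (not_le.mpr hj))
  rw [hfac, hunit, div_one, one_mul]
  have hp1 : (1 : ℝ) < p := by exact_mod_cast hp.one_lt
  exact zpow_lt_one_of_neg₀ hp1 (by norm_num)

/-- **Two-variable total decay `≤` cyclotomic order** — verbatim the registered XL stub `stub_gsTotalDecayLeCycOrder` of line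
`ub_schneider_squeeze`, CONDITIONAL on the named fact `greenbergStevens_kitagawa_ratio_interpolation` (GS93 Thm 5.15 /
Kitagawa94 in ratio form) — from the landed analytic rate lemma `stub_twoVarRateOfOrder` and weight bookkeeping
(`k = 2 + b t`, `t = 2(p-1)p^{m+m₀}t₀`, `t₀ = 1 + p(J+1)`, `s = 1 + a t`). [cite: GreenbergStevens1993, Thm 5.15] -/
theorem lambdaLayerOne_gsTotalDecayLeCycOrder
    (hGS : Literature.NumberTheory.EllipticCurves.greenbergStevens_kitagawa_ratio_interpolation) :
    ∀ (W : WeierstrassCurve ℚ) [W.IsElliptic] [W.IsGloballyMinimal] (_ : NeZero (W.conductorNorm ℤ)) (p : ℕ) [Fact p.Prime], 5 ≤ p → W.HasGoodReductionAtPrime p → ¬ (p : ℤ) ∣ W.frobeniusTrace p → ¬ (p : ℤ) ∣ (W.frobeniusTrace p) ^ 2 - 1 → W.HasSurjectiveModNGaloisRep p → (∀ (M : ℕ) (_ : NeZero M) (g : CuspForm (CongruenceSubgroup.Gamma0 M) 2) (ι : Literature.NumberTheory.EllipticCurves.ModularForms.coeffField g →+* PadicAlgCl p), M ∣ W.conductorNorm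 ℤ * p → Literature.NumberTheory.EllipticCurves.ModularForms.IsNewform0 g → ‖ι ⟨(UpperHalfPlane.qExpansion 1 ⇑g).coeff p, Literature.NumberTheory.EllipticCurves.ModularForms.coeff_mem_coeffField g p⟩‖ = 1 → (∀ ℓ : ℕ, ℓ.Prime → ¬ ℓ ∣ W.conductorNorm ℤ * p → ‖ι ⟨(UpperHalfPlane.qExpansion 1 ⇑g).coeff ℓ, Literature.NumberTheory.EllipticCurves.ModularForms.coeff_mem_coeffField g ℓ⟩ - ((W.frobeniusTrace ℓ : ℤ) : PadicAlgCl p)‖ < 1) → M = W.conductorNorm ℤ ∧ ∀ n : ℕ, (UpperHalfPlane.qExpansion 1 ⇑g).coeff n = ((W.LFunction n : ℤ) : ℂ)) → ∀ (f : CuspForm (CongruenceSubgroup.Gamma0 (W.conductorNorm ℤ)) 2), Literature.NumberTheory.EllipticCurves.ModularForms.IsNewformOf W f → ∀ n : ℕ, (Literature.NumberTheory.EllipticCurves.padicLFunction f (Literature.NumberTheory.EllipticCurves.unitRoot W p : ℚ_[p])).order ≤ n → ∃ (a b : ℕ), 0 < b ∧ 2 * a < b ∧ ∀ J : ℕ,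 ∃ C : ℕ, ∀ m : ℕ, ∃ (k : ℤ) (g : CuspForm (CongruenceSubgroup.Gamma0 (W.conductorNorm ℤ)) k) (ι : Literature.NumberTheory.EllipticCurves.ModularForms.coeffField g →+* PadicAlgCl p) (s : ℕ), (2 * b * (p - 1) * p ^ m : ℤ) ∣ (k - 2) ∧ (2 * J + 3 : ℤ) ≤ k ∧ (b : ℤ) * ((s : ℤ) - 1) = a * (k - 2) ∧ Literature.NumberTheory.EllipticCurves.ModularForms.IsNewform0 g ∧ ‖ι ⟨(UpperHalfPlane.qExpansion 1 ⇑g).coeff p, Literature.NumberTheory.EllipticCurves.ModularForms.coeff_mem_coeffField g p⟩‖ = 1 ∧ (∀ ℓ : ℕ, ℓ.Prime → ¬ ℓ ∣ W.conductorNorm ℤ * p → ‖ι ⟨(UpperHalfPlane.qExpansion 1 ⇑g).coeff ℓ, Literature.NumberTheory.EllipticCurves.ModularForms.coeff_mem_coeffField g ℓ⟩ - ((W.frobeniusTrace ℓ : ℤ) : PadicAlgCl p)‖ < 1) ∧ ∀ (j : ℕ), Odd j → 3 ≤ j → j ≤ 2 * J + 1 → ∃ hR : (∫ t in Set.Ioi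 (0 : ℝ), ((t : ℂ) ^ (s - 1)) * g (UpperHalfPlane.ofComplex ((t : ℂ) * Complex.I))) / (∫ t in Set.Ioi (0 : ℝ), ((t : ℂ) ^ (j - 1)) * g (UpperHalfPlane.ofComplex ((t : ℂ) * Complex.I))) ∈ Literature.NumberTheory.EllipticCurves.ModularForms.coeffField g, 1 ≤ ‖ι ⟨_, hR⟩‖ * (p : ℝ) ^ (n * (m + 1) + C) := by
  intro W _ _ hN p _ h5 hgood hord hna hsurj hBr f hf n horder
  classical
  have hp : p.Prime := Fact.out
  have hp2 : p ≠ 2 := by omega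
  have hp1 : (1 : ℝ) < p := by exact_mod_cast hp.one_lt
  set α : ℚ_[p] := (Literature.NumberTheory.EllipticCurves.unitRoot W p : ℚ_[p]) with hα
  set γ : ℚ_[p] := ((Literature.NumberTheory.EllipticCurves.cyclotomicGenerator p : ℕ) : ℚ_[p]) with hγ
  have hγ' : γ = ((1 + p : ℕ) : ℚ_[p]) := by
    simp [hγ, Literature.NumberTheory.EllipticCurves.cyclotomicGenerator,
      Literature.NumberTheory.EllipticCurves.cyclotomicExponent, hp2]
  -- the named fact: the two-variable object and the branch members
  obtain ⟨F, M, c, hc, hFM, hF0, hk⟩ :=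
    hGS W hN p h5 hgood hord hna hsurj hBr f hf
  -- a non-zero coefficient of `L_p` in degree `≤ n`
  obtain ⟨j₀, hj₀n, hj₀⟩ : ∃ j₀ : ℕ, j₀ ≤ n ∧
      Literature.NumberTheory.EllipticCurves.padicLCoeff f α j₀ ≠ 0 := by
    by_contra hall
    push Not at hall
    have hle : ((n + 1 : ℕ) : ℕ∞) ≤
        (Literature.NumberTheory.EllipticCurves.padicLFunction f α).order := by
      apply PowerSeries.nat_le_order
      intro i hi
      rw [Literature.NumberTheory.EllipticCurves.coeff_padicLFunction]
      exact hall i (by omega)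
    have h' : ((n + 1 : ℕ) : ℕ∞) ≤ (n : ℕ∞) := hle.trans horder
    have : n + 1 ≤ n := by exact_mod_cast h'
    omega
  have hF0j : F 0 j₀ ≠ 0 := by rw [hF0 j₀]; exact mul_ne_zero hc hj₀
  -- the landed analytic rate lemma: slope, threshold and constant
  obtain ⟨a, b, hb, hab, m₀, C, hrate⟩ := stub_twoVarRateOfOrder p hp2 F M n hFM ⟨j₀, hj₀n, hF0j⟩
  refine ⟨a, b, hb, hab, fun J => ⟨n * m₀ + C, fun m => ?_⟩⟩
  -- the weight `k = 2 + b t`, `t = 2 (p-1) p^(m+m₀) t₀`, `t₀ = 1 + p (J+1)`, and `s = 1 + a t`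
  have hp1le : 1 ≤ p := hp.one_le
  set e : ℕ := m + m₀ with he
  set t₀ : ℕ := 1 + p * (J + 1) with ht₀
  set t : ℕ := 2 * (p - 1) * p ^ e * t₀ with ht
  set s : ℕ := 1 + a * t with hs
  set k : ℤ := 2 + (b : ℤ) * (t : ℤ) with hkdef
  have ht₀pos : 0 < t₀ := by positivity
  have hpe : 0 < 2 * (p - 1) * p ^ e := by
    have : 0 < p - 1 := by omega
    positivity
  have htpos : 0 < t := Nat.mul_pos hpe ht₀pos
  have htge : t₀ ≤ t := Nat.le_mul_of_pos_left t₀ hpe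
  have ht₀ge : 5 * J + 6 ≤ t₀ := by
    have : 5 * (J + 1) ≤ p * (J + 1) := Nat.mul_le_mul_right _ h5
    omega
  have htJ : (5 * J + 6 : ℤ) ≤ (t : ℤ) := by exact_mod_cast ht₀ge.trans htge
  have hbt : (t : ℤ) ≤ (b : ℤ) * (t : ℤ) := by
    have hb1 : (1 : ℤ) ≤ b := by exact_mod_cast hb
    nlinarith
  have hk2 : k - 2 = (b : ℤ) * (t : ℤ) := by rw [hkdef]; ring
  have hkgt : 2 < k := by
    have : (0 : ℤ) < (b : ℤ) * (t : ℤ) := by positivity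
    omega
  have hkJ : (2 * J + 3 : ℤ) ≤ k := by omega
  have hk4J : (4 * J + 4 : ℤ) ≤ k := by omega
  have htcast : (t : ℤ) = 2 * ((p : ℤ) - 1) * (p : ℤ) ^ e * (t₀ : ℤ) := by
    rw [ht]; push_cast [Nat.cast_sub hp1le]; ring
  have hdiv : (2 * b * (p - 1) * p ^ m : ℤ) ∣ (k - 2) := by
    rw [hk2, htcast, he, pow_add]
    exact ⟨(p : ℤ) ^ m₀ * t₀, by ring⟩
  have hpdiv : ((p : ℤ) - 1) ∣ (k - 2) := by
    rw [hk2, htcast]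
    exact ⟨(b : ℤ) * 2 * (p : ℤ) ^ e * t₀, by ring⟩
  have hsk : (b : ℤ) * ((s : ℤ) - 1) = a * (k - 2) := by
    rw [hk2, hs]; push_cast; ring
  have hsodd : Odd s := ⟨a * ((p - 1) * p ^ e * t₀), by rw [hs, ht]; ring⟩
  have h2s : 2 * (s : ℤ) < k := by
    have hab' : (2 * a : ℤ) < b := by exact_mod_cast hab
    have htpos' : (0 : ℤ) < t := by exact_mod_cast htpos
    have := mul_lt_mul_of_pos_right hab' htpos'
    rw [hkdef, hs]; push_cast; nlinarith
  -- the branch member of weight `k`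
  obtain ⟨g, ι, hnew, hordg, hcong, hsj⟩ := hk k hkgt hpdiv
  refine ⟨k, g, ι, s, hdiv, hkJ, hsk, hnew, hordg, hcong, fun j hjodd hj3 hjJ => ?_⟩
  have h2j : 2 * (j : ℤ) < k := by
    have : (j : ℤ) ≤ 2 * J + 1 := by exact_mod_cast hjJ
    omega
  obtain ⟨hR, hnorm⟩ := hsj s j hsodd hjodd h2s hj3 h2j
  refine ⟨hR, ?_⟩
  have hkt : (k - 2).toNat = t * b := by
    rw [hk2]
    have : (b : ℤ) * (t : ℤ) = ((t * b : ℕ) : ℤ) := by push_cast; ring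
    rw [this, Int.toNat_natCast]
  have hs1 : s - 1 = t * a := by rw [hs, Nat.add_sub_cancel_left, mul_comm]
  -- valuation of `t`
  have hvt : padicValNat p t = e := by
    have h2p1 : ¬ p ∣ 2 * (p - 1) := by
      intro h
      rcases (Nat.Prime.dvd_mul hp).mp h with h2 | h1
      · exact hp2 ((Nat.prime_dvd_prime_iff_eq hp Nat.prime_two).mp h2)
      · exact absurd (Nat.le_of_dvd (by omega) h1) (by omega)
    have ht₀ndvd : ¬ p ∣ t₀ := by
      intro h
      have h' := Nat.dvd_sub h (Nat.dvd_mul_right p (J + 1))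
      rw [ht₀, Nat.add_sub_cancel] at h'
      exact hp.one_lt.ne' (Nat.dvd_one.mp h')
    rw [ht, padicValNat.mul hpe.ne' ht₀pos.ne', padicValNat.mul (by omega) (by positivity),
      padicValNat.eq_zero_of_not_dvd h2p1, padicValNat.prime_pow,
      padicValNat.eq_zero_of_not_dvd ht₀ndvd]
    ring
  have hylt : ‖((1 + p : ℕ) : ℚ_[p]) ^ (j - 1) - 1‖ < 1 := by
    rw [stub_normCycPow p hp2 (j - 1) (by omega)]
    calc (p : ℝ) ^ (-(padicValNat p (j - 1) : ℤ) - 1) ≤ (p : ℝ) ^ (-1 : ℤ) :=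
          zpow_le_zpow_right₀ hp1.le (by omega)
      _ < 1 := zpow_lt_one_of_neg₀ hp1 (by norm_num)
  -- the analytic rate lemma at `t`, dressed back into the crux's coordinates
  have key := hrate t htpos (by omega) (((1 + p : ℕ) : ℚ_[p]) ^ (j - 1) - 1) ‖ι ⟨_, hR⟩‖ hylt (norm_nonneg _)
  rw [← hkt, ← hs1, ← hγ', hvt] at key
  have hexp : n * (m + 1) + (n * m₀ + C) = n * (e + 1) + C := by rw [he]; ring
  rw [hexp]
  exact key hnorm

/-- **The conditional bridge of line `lambda-layer-one`** (registered stub `stub_edgeDecay_of_layerOneUnit`): the crux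
`EdgeDecay` BY NAME from C⁺ (`LayerOneUnitSomewhere`: at one admissible prime `p > r_an` with (Br) some level-`p²`
Riemann sum `RS(j,1)` of the Mazur–Swinnerton-Dyer measure, `j ≤ r_an`, is a `p`-adic unit — conjecture-grade,
Kundu–Ray), modularity (`exists_isNewformOf`) and the Greenberg–Stevens/Kitagawa ratio interpolation
(`greenbergStevens_kitagawa_ratio_interpolation`). [folklore] -/
theorem stub_edgeDecay_of_layerOneUnit :
    (∀ (W : WeierstrassCurve ℚ) [W.IsElliptic] [W.IsGloballyMinimal], 2 ≤ W.analyticRank → (∃ (p₀ : ℕ) (_ : Fact p₀.Prime), 5 ≤ p₀ ∧ W.HasGoodReductionAtPrime p₀ ∧ ¬ (p₀ : ℤ) ∣ W.frobeniusTrace p₀ ∧ W.HasSurjectiveModNGaloisRep p₀) → ∃ (_ : NeZero (W.conductorNorm ℤ)) (p : ℕ) (_ : Fact p.Prime), 5 ≤ p ∧ W.HasGoodReductionAtPrime p ∧ ¬ (p : ℤ) ∣ W.frobeniusTrace p ∧ ¬ (p : ℤ) ∣ (W.frobeniusTrace p) ^ 2 - 1 ∧ W.HasSurjectiveModNGaloisRep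 p ∧ (∀ (M : ℕ) (_ : NeZero M) (g : CuspForm (CongruenceSubgroup.Gamma0 M) 2) (ι : Literature.NumberTheory.EllipticCurves.ModularForms.coeffField g →+* PadicAlgCl p), M ∣ W.conductorNorm ℤ * p → Literature.NumberTheory.EllipticCurves.ModularForms.IsNewform0 g → ‖ι ⟨(UpperHalfPlane.qExpansion 1 ⇑g).coeff p, Literature.NumberTheory.EllipticCurves.ModularForms.coeff_mem_coeffField g p⟩‖ = 1 → (∀ ℓ : ℕ, ℓ.Prime → ¬ ℓ ∣ W.conductorNorm ℤ * p → ‖ι ⟨(UpperHalfPlane.qExpansion 1 ⇑g).coeff ℓ, Literature.NumberTheory.EllipticCurves.ModularForms.coeff_mem_coeffField g ℓ⟩ - ((W.frobeniusTrace ℓ : ℤ) : PadicAlgCl p)‖ < 1) → M = W.conductorNorm ℤ ∧ ∀ n : ℕ, (UpperHalfPlane.qExpansion 1 ⇑g).coeff n = ((W.LFunction n : ℤ) : ℂ)) ∧ W.analyticRank < p ∧ ∀ (f : CuspForm (CongruenceSubgroup.Gamma0 (W.conductorNorm ℤ)) 2), Literature.NumberTheory.EllipticCurves.ModularForms.IsNewformOf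 W f → ∃ j : ℕ, j ≤ W.analyticRank ∧ ‖Literature.NumberTheory.EllipticCurves.padicLRiemannSum f (Literature.NumberTheory.EllipticCurves.unitRoot W p : ℚ_[p]) j 1‖ = 1) → Literature.NumberTheory.EllipticCurves.ModularForms.exists_isNewformOf → Literature.NumberTheory.EllipticCurves.greenbergStevens_kitagawa_ratio_interpolation → Summit.BirchSwinnertonDyer.BirchSwinnertonDyer.Theses.TangentCone.EdgeDecay := by
  intro hC hMod hGS W _ _ h2 hp₀
  obtain ⟨hN, p, hp, h5, hgood, hord, hna, hsurj, hBr, hpr, hunit⟩ :=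
    hC W h2 hp₀
  haveI := hp
  haveI := hN
  obtain ⟨f, hf⟩ := hMod W
  obtain ⟨j, hjr, hju⟩ := hunit f hf
  have hμ := lambdaLayerOne_norm_msdMeasure_le_one h5 hgood hord hna hf
  have hordAt : Literature.NumberTheory.EllipticCurves.IsOrdinaryAt W p := ⟨hgood, hord⟩
  have hjp : j < p := by omega
  have horder : (Literature.NumberTheory.EllipticCurves.padicLFunction f
      (Literature.NumberTheory.EllipticCurves.unitRoot W p : ℚ_[p])).order ≤ W.analyticRank :=
    (lambdaLayerOne_order_le_of_layerOneUnit hordAt hf hμ hjp hju).trans (by exact_mod_cast hjr)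
  obtain ⟨a, b, hb, hab, hJ⟩ :=
    lambdaLayerOne_gsTotalDecayLeCycOrder hGS W hN p h5 hgood hord hna hsurj hBr f hf W.analyticRank horder
  exact ⟨hN, p, hp, h5, hgood, hord, hna, hsurj, hBr, a, b, hb, hab, hJ⟩

end Summit.BirchSwinnertonDyer.BirchSwinnertonDyer.Theorems
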